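import Literature.NumberTheory.EllipticCurves.IwasawaTowerTorsionProofs
import Literature.NumberTheory.EllipticCurves.IwasawaSelmerControlKernelCardProofs
import Literature.NumberTheory.EllipticCurves.IwasawaSelmerProofs
import Literature.NumberTheory.EllipticCurves.SelmerGroupOverTorsionFinite
import Literature.NumberTheory.EllipticCurves.SelmerCorankProofs
import HarnessLib

/-!
# `Sel_{p^∞}(E/K_j) ↪ Sel_{p^∞}(E/K_k)` for the layers `j ≤ k` of a `ℤ_p`-extension when `E(K)[p] = 0`;
# the `p`-Selmer counts of the layers can only GROW up the tower

`Proofs` file (theorems only; no definition, no named fact, no instance, no `sorry`) in topic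
`NumberTheory/EllipticCurves`, in the objects of `IwasawaSelmer` / `SubgroupSelmer` (`h_n = W.layerToInfty κ n`,
`Sel_n = W.selmerLayer κ n ⊆ H¹(K_n, E[p^∞]) = W.subgroupH1 p (κ.layerSubgroup n)`, restriction `W.resOfLe p`). For an elliptic
curve `E/K` over a number field, a prime `p`, ANY `ℤ_p`-extension `κ` and layers `j ≤ k`:

* `WeierstrassCurve.layerToInfty_comp_resOfLe` — `h_k ∘ res_{j→k} = h_j` (transitivity of restriction along
  `Gal(K̄/K_∞) ≤ Gal(K̄/K_k) ≤ Gal(K̄/K_j)`);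
* `WeierstrassCurve.layerToInfty_injective_of_forall_smul_eq_zero` — `h_j` is injective when `E(K)[p] = 0`: Greenberg's Lemma 3.1
  (`ker h_n ≅ H¹(Γ_n, B)`, `B = E(K_∞)[p^∞]`, inflation–restriction) with `B = 0` by the pro-`p` fixed-point argument (tree
  `fixedPoints_kerSubgroup_geomPrimaryTorsion_eq_bot`, `natCard_ker_layerToInfty_eq_natCard_fixedPoints`,
  `natCard_fixedBy_layerSubgroup_eq_one`; the same three lines as the summit-side
  `Rank1Residual.Additive.layerToInfty_injective_of_no_pTorsion`, restated here so that Literature consumers need no summit import);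
* ★ `WeierstrassCurve.resOfLe_layer_injective` — **`res_{j→k} : H¹(K_j, E[p^∞]) → H¹(K_k, E[p^∞])` is injective** (`h_k ∘ res = h_j`);
* `WeierstrassCurve.resOfLe_mem_selmerLayer`, ★ `WeierstrassCurve.exists_injective_selmerLayer_hom` — **`Sel_{p^∞}(E/K_j) ↪
  Sel_{p^∞}(E/K_k)`** (restriction preserves the local conditions, `resOfLe_mem_selmerGroupOver`);
* ★ `WeierstrassCurve.natCard_torsionBy_selmerLayer_mono_of_finite` / `…_dvd` / `…_mono` — **`#Sel_{p^∞}(E/K_j)[m] ≤` and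
  `∣ #Sel_{p^∞}(E/K_k)[m]`** (at `m = p` unconditionally: the `p`-torsion is finite, Silverman X.4.2(b) at the open subgroup
  `κ⁻¹(p^kℤ_p)`, tree `finite_torsionBy_selmerGroupOver`).

Written for cell `bsd-f1-sign2` (crux C2 stmt-BirchSwinnertonDyer-22298, seat `bsd-line-att-p5` gen 45): the monotonicity puts a
FLOOR under every layer of the descent doors (`Summits/…/AlignedTransportAtTwoMainConjectureOfRankZeroBSDAtTwoSelmerLayerDescentMonotone`).
Nothing about BSD or any main conjecture is asserted.

## References

* [GreenbergLNM1716] R. Greenberg, *Iwasawa theory for elliptic curves*, LNM 1716 (1999), §1 p. 60 (the maps `s_n`, `h_n`),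
  §3 Lemma 3.1 (p. 86: "`ker(h_n) ≅ H¹(Γ_n, B)`").
* [SerreGaloisCohomology1997] J.-P. Serre, *Galois Cohomology*, I.§2.4 (res), I.§2.6 (inflation–restriction).
* [SilvermanAEC2009] J. H. Silverman, *The Arithmetic of Elliptic Curves*, 2nd ed., Thm. X.4.2(b).
* [Washington1997] L. C. Washington, *Introduction to Cyclotomic Fields*, §13.1 (the layers `K_n`).
-/

set_option autoImplicit false

noncomputable section

open scoped Classical AddSubgroup

open Literature.NumberTheory.EllipticCurves Literature.NumberTheory.GaloisRepresentations

universe u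

namespace WeierstrassCurve

variable {K : Type u} [Field K] [NumberField K] (W : WeierstrassCurve K) [W.IsElliptic]
  {p : ℕ} [hp : Fact p.Prime] (κ : ZpExtension K p)

omit [NumberField K] [W.IsElliptic] in
/-- **`h_k ∘ res_{j→k} = h_j`**: restriction from the layer `K_j` to `K_∞` factors through the layer `K_k ⊇ K_j` (transitivity of
restriction, `resOfLe_comp_holds`, along `Gal(K̄/K_∞) ≤ Gal(K̄/K_k) ≤ Gal(K̄/K_j)`). [cite: SerreGaloisCohomology1997, I.§2.4]
[cite: GreenbergLNM1716, §1 p. 60] -/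
theorem layerToInfty_comp_resOfLe {j k : ℕ} (hjk : j ≤ k) :
    (W.layerToInfty κ k).comp (W.resOfLe p (κ.layerSubgroup_antitone hjk)) = W.layerToInfty κ j :=
  W.resOfLe_comp_holds p (κ.kerSubgroup_le_layerSubgroup k) (κ.layerSubgroup_antitone hjk)

/-- **`h_n : H¹(K_n, E[p^∞]) → H¹(K_∞, E[p^∞])` is injective when `E(K)[p] = 0`**, for ANY `ℤ_p`-extension of a number field:
`#ker h_n = #E[p^∞]^{Gal(K̄/K_n)}` (Greenberg's Lemma 3.1 / proof of Lemma 4.3, tree `natCard_ker_layerToInfty_eq_natCard_fixedPoints`,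
its finiteness hypothesis supplied by `finite_fixedPoints_kerSubgroup_geomPrimaryTorsion`) `= 1` (`natCard_fixedBy_layerSubgroup_eq_one`).
[cite: GreenbergLNM1716, §3 Lemma 3.1 (p. 86) and §4 Lemma 4.3 (p. 103)] [cite: SerreGaloisCohomology1997, I.§2.6] -/
theorem layerToInfty_injective_of_forall_smul_eq_zero (hK : ∀ P : W.toAffine.Point, p • P = 0 → P = 0) (n : ℕ) :
    Function.Injective (W.layerToInfty κ n) := by
  -- adapted from Summits/BirchSwinnertonDyer/Rank1Residual/Additive/BudgetFromRationalClasses.lean §2 (same three lines)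
  haveI := W.finite_fixedPoints_kerSubgroup_geomPrimaryTorsion κ hK
  have h := W.natCard_ker_layerToInfty_eq_natCard_fixedPoints κ n
  rw [W.natCard_fixedBy_layerSubgroup_eq_one κ hK n] at h
  exact (AddMonoidHom.ker_eq_bot_iff _).mp (AddSubgroup.eq_bot_of_card_eq _ h)

/-- ★ **The restriction `H¹(K_j, E[p^∞]) → H¹(K_k, E[p^∞])` between layers `j ≤ k` of ANY `ℤ_p`-extension of a number field is
INJECTIVE when `E(K)` has no point of order `p`**: `h_k ∘ res_{j→k} = h_j` and `h_j` is injective.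
[cite: GreenbergLNM1716, §3 Lemma 3.1 (p. 86)] [cite: SerreGaloisCohomology1997, I.§2.6] -/
theorem resOfLe_layer_injective (hK : ∀ P : W.toAffine.Point, p • P = 0 → P = 0) {j k : ℕ} (hjk : j ≤ k) :
    Function.Injective (W.resOfLe p (κ.layerSubgroup_antitone hjk)) := by
  have hinj := W.layerToInfty_injective_of_forall_smul_eq_zero κ hK j
  rw [← W.layerToInfty_comp_resOfLe κ hjk, AddMonoidHom.coe_comp] at hinj
  exact hinj.of_comp

omit [W.IsElliptic] in
/-- Restriction between layers carries `Sel_{p^∞}(E/K_j)` into `Sel_{p^∞}(E/K_k)` (restriction preserves the local conditions and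
commutes with conjugation; tree `resOfLe_mem_selmerGroupOver` for the normal subgroups `κ⁻¹(p^kℤ_p) ≤ κ⁻¹(p^jℤ_p)`).
[cite: GreenbergLNM1716, §1 Thm. 1.2 and p. 60] -/
theorem resOfLe_mem_selmerLayer {j k : ℕ} (hjk : j ≤ k) {c : W.subgroupH1 p (κ.layerSubgroup j)}
    (hc : c ∈ W.selmerLayer κ j) : W.resOfLe p (κ.layerSubgroup_antitone hjk) c ∈ W.selmerLayer κ k :=
  W.resOfLe_mem_selmerGroupOver p (κ.layerSubgroup_antitone hjk) hc

/-- ★ **`Sel_{p^∞}(E/K_j) ↪ Sel_{p^∞}(E/K_k)` for `j ≤ k` when `E(K)[p] = 0`**: the restriction, co-restricted to the Selmer groups,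
is an injective homomorphism (existence form — no definition is introduced). [cite: GreenbergLNM1716, §3 Lemma 3.1 (p. 86)] -/
theorem exists_injective_selmerLayer_hom (hK : ∀ P : W.toAffine.Point, p • P = 0 → P = 0) {j k : ℕ} (hjk : j ≤ k) :
    ∃ f : W.selmerLayer κ j →+ W.selmerLayer κ k, Function.Injective f ∧
      ∀ c : W.selmerLayer κ j,
        ((f c : W.selmerLayer κ k) : W.subgroupH1 p (κ.layerSubgroup k)) = W.resOfLe p (κ.layerSubgroup_antitone hjk) c := by
  refine ⟨((W.resOfLe p (κ.layerSubgroup_antitone hjk)).comp (W.selmerLayer κ j).subtype).codRestrict (W.selmerLayer κ k)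
      (fun c ↦ W.resOfLe_mem_selmerLayer κ hjk c.2), fun a b hab ↦ ?_, fun c ↦ rfl⟩
  apply Subtype.ext
  apply W.resOfLe_layer_injective κ hK hjk
  simpa using congrArg (fun x : W.selmerLayer κ k ↦ (x : W.subgroupH1 p (κ.layerSubgroup k))) hab

/-- ★ **`#Sel_{p^∞}(E/K_j)[m] ≤ #Sel_{p^∞}(E/K_k)[m]`** for `j ≤ k`, every `m : ℕ`, when `E(K)[p] = 0` and the larger count is finite
(automatic at `m = p`, see `natCard_torsionBy_selmerLayer_mono`): an injective homomorphism restricts to an injection of the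
`m`-torsion subgroups (`torsionByMap`). [cite: GreenbergLNM1716, §3 Lemma 3.1 (p. 86)] [cite: SilvermanAEC2009, Thm. X.4.2(b)] -/
theorem natCard_torsionBy_selmerLayer_mono_of_finite (hK : ∀ P : W.toAffine.Point, p • P = 0 → P = 0) {j k : ℕ} (hjk : j ≤ k)
    (m : ℕ) [Finite ((↥(W.selmerLayer κ k))[(m : ℤ)])] :
    Nat.card ((↥(W.selmerLayer κ j))[(m : ℤ)]) ≤ Nat.card ((↥(W.selmerLayer κ k))[(m : ℤ)]) := by
  obtain ⟨f, hf, -⟩ := W.exists_injective_selmerLayer_hom κ hK hjk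
  refine Nat.card_le_card_of_injective (torsionByMap f m) fun a b hab ↦ ?_
  apply Subtype.ext
  apply hf
  simpa using congrArg (fun x : (↥(W.selmerLayer κ k))[(m : ℤ)] ↦ (x : W.selmerLayer κ k)) hab

/-- **`#Sel_{p^∞}(E/K_j)[m] ∣ #Sel_{p^∞}(E/K_k)[m]`** for `j ≤ k` when `E(K)[p] = 0` (an injective homomorphism embeds a subgroup;
Lagrange; both sides read `0` when infinite). [cite: GreenbergLNM1716, §3 Lemma 3.1 (p. 86)] -/
theorem natCard_torsionBy_selmerLayer_dvd (hK : ∀ P : W.toAffine.Point, p • P = 0 → P = 0) {j k : ℕ} (hjk : j ≤ k) (m : ℕ) :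
    Nat.card ((↥(W.selmerLayer κ j))[(m : ℤ)]) ∣ Nat.card ((↥(W.selmerLayer κ k))[(m : ℤ)]) := by
  obtain ⟨f, hf, -⟩ := W.exists_injective_selmerLayer_hom κ hK hjk
  refine AddSubgroup.card_dvd_of_injective (torsionByMap f m) fun a b hab ↦ ?_
  apply Subtype.ext
  apply hf
  simpa using congrArg (fun x : (↥(W.selmerLayer κ k))[(m : ℤ)] ↦ (x : W.selmerLayer κ k)) hab

/-- ★ **`#Sel_{p^∞}(E/K_j)[p] ≤ #Sel_{p^∞}(E/K_k)[p]` for `j ≤ k` when `E(K)[p] = 0`** — unconditionally, since the `p`-torsion of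
the layer Selmer group is finite (Silverman X.4.2(b) at the open subgroup `κ⁻¹(p^kℤ_p)`, tree `finite_torsionBy_selmerGroupOver`).
In words: **the `p`-Selmer counts of the layers of a `ℤ_p`-tower can only grow.** [cite: GreenbergLNM1716, §3 Lemma 3.1 (p. 86)]
[cite: SilvermanAEC2009, Thm. X.4.2(b)] -/
theorem natCard_torsionBy_selmerLayer_mono (hK : ∀ P : W.toAffine.Point, p • P = 0 → P = 0) {j k : ℕ} (hjk : j ≤ k) :
    Nat.card ((↥(W.selmerLayer κ j))[(p : ℤ)]) ≤ Nat.card ((↥(W.selmerLayer κ k))[(p : ℤ)]) := by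
  haveI : Finite ((↥(W.selmerLayer κ k))[(p : ℤ)]) :=
    W.finite_torsionBy_selmerGroupOver p (κ.layerSubgroup k) (κ.isOpen_layerSubgroup k)
  exact W.natCard_torsionBy_selmerLayer_mono_of_finite κ hK hjk p

/-- The same monotonicity from the torsion-order reading `p ∤ #E(K)_tors` of the hypothesis: a non-zero `P` with `p • P = 0`
would have order `p` dividing `#E(K)_tors` (tree `finite_torsion_holds`). [cite: GreenbergLNM1716, §3 Lemma 3.1 (p. 86)]
[cite: SilvermanAEC2009, Cor. VIII.6.7.1] -/
theorem natCard_torsionBy_selmerLayer_mono_of_not_dvd_torsionOrder (htors : ¬ p ∣ W.torsionOrder) {j k : ℕ} (hjk : j ≤ k) :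
    Nat.card ((↥(W.selmerLayer κ j))[(p : ℤ)]) ≤ Nat.card ((↥(W.selmerLayer κ k))[(p : ℤ)]) := by
  refine W.natCard_torsionBy_selmerLayer_mono κ (fun P hP ↦ ?_) hjk
  -- adapted from Summits/BirchSwinnertonDyer/Rank1Residual/Additive/BudgetFromRationalClasses.lean §1
  by_contra hne
  apply htors
  have hfin : IsOfFinAddOrder P := isOfFinAddOrder_iff_nsmul_eq_zero.mpr ⟨p, hp.out.pos, hP⟩
  have hord : addOrderOf P = p := by
    rcases (Nat.dvd_prime hp.out).mp (addOrderOf_dvd_of_nsmul_eq_zero hP) with h | h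
    · exact absurd (AddMonoid.addOrderOf_eq_one_iff.mp h) hne
    · exact h
  have hmem : P ∈ AddCommGroup.torsion W.toAffine.Point := hfin
  have hT : addOrderOf (⟨P, hmem⟩ : AddCommGroup.torsion W.toAffine.Point) = p := by
    rw [← hord]
    exact AddSubgroup.addOrderOf_mk P hmem
  unfold WeierstrassCurve.torsionOrder
  rw [← hT]
  exact addOrderOf_dvd_natCard _

end WeierstrassCurve

end
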